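import Summits.KontsevichZagierPeriods.KontsevichZagierPeriods.Theses.HyperbolicBloch
import Literature.NumberTheory.Transcendental.KZCubicalCalculus
import Literature.NumberTheory.Transcendental.KZCalculusProofs
import Literature.NumberTheory.Transcendental.KZSemiCanonicalReductionProofs
import Summits.KontsevichZagierPeriods.KontsevichZagierPeriods.Theorems.HyperbolicBlochOffTetraSectorKernelStubKernelOfValueOne
import Summits.KontsevichZagierPeriods.KontsevichZagierPeriods.Theorems.HyperbolicBlochOffTetraSectorKernelStubValueOneOfOrbit
import Summits.KontsevichZagierPeriods.KontsevichZagierPeriods.Theorems.HyperbolicBlochOffTetraSectorKernelStubCubeDensityTransfer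
import Summits.KontsevichZagierPeriods.KontsevichZagierPeriods.Theorems.HyperbolicBlochOffTetraSectorKernelStubDimensionDrop
import Summits.KontsevichZagierPeriods.KontsevichZagierPeriods.Theorems.HyperbolicBlochOffTetraSectorKernelStubAffineOrbit
import Summits.KontsevichZagierPeriods.KontsevichZagierPeriods.Theorems.SymplecticScissorsVolumeFormOffPlaneDimLeOne

/-!
# `OffTetraSectorKernel` (stmt-KontsevichZagierPeriods-10557), line `odd-hyperbolic-ladder`: the residue in
# value-one, cube-orbit and Moser form

The crux `OffTetraSectorKernel` is the kernel form of Kontsevich–Zagier's Conjecture 1 with the Bloch–Wigner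
(`ℚ̄`-ideal-tetrahedron) value-relators adjoined as an oracle `W`: `ker eval ≤ relations ⊔ W`. It is summit-strength
(crux disproof file, §1), so no line closes it; what the line `odd-hyperbolic-ladder` delivers is the sharpest
elementary form of the residue together with its unconditional frontier. This file assembles the landed transfer
stubs of skeleton v6 (`stub_kernelOfValueOne`, `stub_valueOneOfOrbit`, `stub_cubeDensityTransfer`,
`stub_dimensionDrop`, `stub_affineOrbit`) into EQUIVALENCES, for an ARBITRARY subgroup `W` of the formal group and
then for the crux's own oracle:

* KERNEL FORM `⟺` VALUE-ONE FORM (`kernel_iff_valueOne`): every representation of value exactly `1` reaches the unit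
  cube `[0,1]^d` of its dimension (integrand `1`) modulo `relations ⊔ W`;
* `⟺` CUBE-ORBIT FORM (`kernel_iff_cubeOrbit`): every compact top-dimensional integrand-`1` `ℚ`-semialgebraic solid
  of volume `1` reaches the unit cube of its dimension modulo `relations ⊔ W` — one solid, one integer, one reference
  body per dimension, no period constant left in the statement;
* `⟺` MOSER FORM (`kernel_iff_moserForm`): every non-negative `ℚ`-semialgebraic density of mass `1` on a unit cube is
  move-equivalent modulo `relations ⊔ W` to the uniform density (`ℚ`-semialgebraic Moser-with-scissors).

The two towers interleave in the dimension (orbit at `d + 1` ⇒ value one, hence orbit and Moser, at `d`: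
`stub_valueOneOfOrbit`; Moser at `d + 1` ⇒ orbit at `d + 1`: `stub_cubeDensityTransfer`), the induction step is
typed (`densityStep_of_omits`: a density omitting a coordinate is the density one dimension down,
`stub_dimensionDrop`), and the unconditional frontier is recorded: orbits of dimension
`≤ 1` close outright (`cubeOrbit_dimLeOne`) and the Euclidean affine sector closes outright in every dimension
(`closure_affineOrbit_le_relations`: `ℤ`-value-relators among real-algebraic affine images of one `ℚ`-semialgebraic
body — `ℚ̄`-simplices, boxes, ellipsoids — are relations; the Dehn invariant of Hilbert's third problem is invisible
to rules (1b) + (2)). The hyperbolic rungs (0, 1 closed; 2 = the oracle) are in the sibling files of leads c1–c3.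

References: M. Kontsevich, D. Zagier, *Periods* (2001), §1.2; J. Viu-Sos, *A semi-canonical reduction for periods of
Kontsevich–Zagier*, IJNT 17 (2021), Thm. 1.1; J. Cresson, J. Viu-Sos, *On the equality of periods of
Kontsevich–Zagier*, JTNB 34 (2022), §1; J. Moser, *On the volume elements on a manifold*, Trans. AMS 120 (1965).
-/

noncomputable section

open Set MeasureTheory
open Literature.NumberTheory.Transcendental

namespace Summit.KontsevichZagierPeriods.HyperbolicBloch.OffTetraSectorKernel

/-! ## §0 Oracle-generic equivalences (`W` any subgroup of `KZ.FormalRep`) -/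

/-- The value of a cube representation is `1`. [folklore] -/
theorem res_value_cubeRep {d : ℕ} (Q : KZ.IntegralRep d) (hQ : Q.domain = KZ.cube d)
    (hQ1 : ∀ x ∈ Q.domain, Q.integrand x = 1) : Q.value = 1 := by
  rw [Q.value_eq_volume_real hQ1, hQ, measureReal_def, KZ.volume_cube, ENNReal.toReal_one]

/-- Kernel form ⇒ value-one form (the difference of two value-`1` representations is a kernel element). [folklore] -/
theorem res_valueOne_of_kernel (W : AddSubgroup KZ.FormalRep)
    (hker : ∀ c : KZ.FormalRep, KZ.eval c = 0 → c ∈ KZ.relations ⊔ W)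
    {d : ℕ} (G Q : KZ.IntegralRep d) (hQ : Q.domain = KZ.cube d) (hQ1 : ∀ x ∈ Q.domain, Q.integrand x = 1)
    (hGv : G.value = 1) : KZ.of G - KZ.of Q ∈ KZ.relations ⊔ W :=
  hker _ (by rw [map_sub, KZ.eval_of, KZ.eval_of, hGv, res_value_cubeRep Q hQ hQ1, sub_self])

/-- **KERNEL FORM ⟺ VALUE-ONE FORM**, modulo any oracle `W`: `ker eval ≤ relations ⊔ W` iff every representation of
value `1`, in every dimension, reaches the unit cube of its dimension modulo `relations ⊔ W`
(`←` is `stub_kernelOfValueOne`: the kernel hypothesis is spent once, as `c + [pt] ≡ [R]` with `R` one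
representation of value `1`). [cite: KontsevichZagier2001, §1.2] -/
theorem kernel_iff_valueOne (W : AddSubgroup KZ.FormalRep) :
    (∀ c : KZ.FormalRep, KZ.eval c = 0 → c ∈ KZ.relations ⊔ W) ↔
    (∀ (d : ℕ) (G Q : KZ.IntegralRep d), Q.domain = KZ.cube d →
      (∀ x ∈ Q.domain, Q.integrand x = 1) → G.value = 1 → KZ.of G - KZ.of Q ∈ KZ.relations ⊔ W) :=
  ⟨fun hker _ G Q hQ hQ1 hGv => res_valueOne_of_kernel W hker G Q hQ hQ1 hGv, stub_kernelOfValueOne W⟩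

/-- **KERNEL FORM ⟺ CUBE-ORBIT FORM**, modulo any oracle `W`: `ker eval ≤ relations ⊔ W` iff, in every dimension,
every compact top-dimensional integrand-`1` solid of volume `1` reaches the unit cube modulo `relations ⊔ W`.
(`←`: the orbit at `d + 1` gives the value-one form at `d`, `stub_valueOneOfOrbit`, through the tree's discharged
semi-canonical reduction of Viu-Sos; then `kernel_iff_valueOne`.) [cite: CressonViusos2022, §1 p. 326] -/
theorem kernel_iff_cubeOrbit (W : AddSubgroup KZ.FormalRep) :
    (∀ c : KZ.FormalRep, KZ.eval c = 0 → c ∈ KZ.relations ⊔ W) ↔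
    (∀ (d : ℕ) (K Q : KZ.IntegralRep d), IsCompact K.domain → (interior K.domain).Nonempty →
      (∀ x ∈ K.domain, K.integrand x = 1) → Q.domain = KZ.cube d →
      (∀ x ∈ Q.domain, Q.integrand x = 1) → K.value = 1 → KZ.of K - KZ.of Q ∈ KZ.relations ⊔ W) := by
  constructor
  · intro hker d K Q _ _ _ hQ hQ1 hKv
    exact res_valueOne_of_kernel W hker K Q hQ hQ1 hKv
  · intro horbit
    exact (kernel_iff_valueOne W).mpr fun d G Q hQ hQ1 hGv =>
      stub_valueOneOfOrbit W d (horbit (d + 1)) G Q hQ hQ1 hGv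

/-- **KERNEL FORM ⟺ MOSER FORM**, modulo any oracle `W`: `ker eval ≤ relations ⊔ W` iff, in every dimension, every
non-negative `ℚ`-semialgebraic density of mass `1` on the unit cube is move-equivalent modulo `relations ⊔ W` to the
uniform density (`ℚ`-semialgebraic Moser-with-scissors). (`←`: Moser at `d + 1` ⇒ orbit at `d + 1`
(`stub_cubeDensityTransfer`) ⇒ value one at `d` (`stub_valueOneOfOrbit`) ⇒ kernel (`stub_kernelOfValueOne`).)
[cite: KontsevichZagier2001, §1.2] -/
theorem kernel_iff_moserForm (W : AddSubgroup KZ.FormalRep) :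
    (∀ c : KZ.FormalRep, KZ.eval c = 0 → c ∈ KZ.relations ⊔ W) ↔
    (∀ (d : ℕ) (G Q : KZ.IntegralRep d), G.domain = KZ.cube d →
      (∀ x ∈ G.domain, 0 ≤ G.integrand x) → Q.domain = KZ.cube d →
      (∀ x ∈ Q.domain, Q.integrand x = 1) → G.value = 1 → KZ.of G - KZ.of Q ∈ KZ.relations ⊔ W) := by
  constructor
  · intro hker d G Q _ _ hQ hQ1 hGv
    exact res_valueOne_of_kernel W hker G Q hQ hQ1 hGv
  · intro hdens
    exact (kernel_iff_valueOne W).mpr fun d G Q hQ hQ1 hGv =>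
      stub_valueOneOfOrbit W d (fun K Q' hKc _ hK1 hQ' hQ'1 hKv =>
        stub_cubeDensityTransfer W d (hdens (d + 1)) K Q' hKc hK1 hQ' hQ'1 hKv) G Q hQ hQ1 hGv

/-- **THE INDUCTION STEP, TYPED**: modulo any `W`, a mass-`1` density on `[0,1]^{d+1}` that OMITS a coordinate
reaches the uniform density as soon as the Moser form holds on `[0,1]^d` (`stub_dimensionDrop` for the density and
for the uniform density). So "make a mass-`1` density omit one variable by moves" is exactly what separates level
`d + 1` of the Moser tower from level `d`. [folklore] -/
theorem densityStep_of_omits (W : AddSubgroup KZ.FormalRep) (d : ℕ)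
    (hdens : ∀ (G Q : KZ.IntegralRep d), G.domain = KZ.cube d →
      (∀ x ∈ G.domain, 0 ≤ G.integrand x) → Q.domain = KZ.cube d →
      (∀ x ∈ Q.domain, Q.integrand x = 1) → G.value = 1 → KZ.of G - KZ.of Q ∈ KZ.relations ⊔ W)
    (i : Fin (d + 1)) (G Q : KZ.IntegralRep (d + 1)) (G' Q' : KZ.IntegralRep d)
    (hG : G.domain = KZ.cube (d + 1)) (hG' : G'.domain = KZ.cube d)
    (hGG' : ∀ x ∈ G.domain, G.integrand x = G'.integrand (i.removeNth x))
    (hG'0 : ∀ x ∈ G'.domain, 0 ≤ G'.integrand x)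
    (hQ : Q.domain = KZ.cube (d + 1)) (hQ' : Q'.domain = KZ.cube d)
    (hQQ' : ∀ x ∈ Q.domain, Q.integrand x = Q'.integrand (i.removeNth x))
    (hQ'1 : ∀ x ∈ Q'.domain, Q'.integrand x = 1) (hGv : G.value = 1) :
    KZ.of G - KZ.of Q ∈ KZ.relations ⊔ W := by
  have eG : KZ.of G - KZ.of G' ∈ KZ.relations := stub_dimensionDrop d i G G' hG hG' hGG'
  have eQ : KZ.of Q - KZ.of Q' ∈ KZ.relations := stub_dimensionDrop d i Q Q' hQ hQ' hQQ'
  have hG'v : G'.value = 1 := (KZ.Equivalent.value_eq_holds eG).symm.trans hGv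
  have hmid : KZ.of G' - KZ.of Q' ∈ KZ.relations ⊔ W := hdens G' Q' hG' hG'0 hQ' hQ'1 hG'v
  have : KZ.of G - KZ.of Q = (KZ.of G - KZ.of G') + (KZ.of G' - KZ.of Q') - (KZ.of Q - KZ.of Q') := by abel
  rw [this]
  exact sub_mem (add_mem (AddSubgroup.mem_sup_left eG) hmid) (AddSubgroup.mem_sup_left eQ)

/-! ## §1 The crux in its three residue forms -/

/-- **`OffTetraSectorKernel` ⟺ ITS VALUE-ONE FORM**: the crux holds iff, for the standard ideal-tetrahedron family
`T`, every representation of value `1` reaches the unit cube of its dimension modulo relations and the tetrahedral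
value-relators. [cite: KontsevichZagier2001, §1.2] -/
theorem offTetraSectorKernel_iff_valueOne :
    Summit.KontsevichZagierPeriods.KontsevichZagierPeriods.Theses.HyperbolicBloch.OffTetraSectorKernel ↔
    ∀ (T : ℂ → Set (Fin 3 → ℝ)), (∀ z, T z = {p | 0 < p 1 ∧ z.re * p 1 < z.im * p 0 ∧
      z.im * (p 0 - 1) < (z.re - 1) * p 1 ∧ 0 < p 2 ∧
      0 < z.im * (p 0 ^ 2 + p 1 ^ 2 + p 2 ^ 2 - p 0) + (z.re - Complex.normSq z) * p 1}) →
    ∀ (d : ℕ) (G Q : KZ.IntegralRep d), Q.domain = KZ.cube d → (∀ x ∈ Q.domain, Q.integrand x = 1) →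
      G.value = 1 →
      KZ.of G - KZ.of Q ∈ KZ.relations ⊔ AddSubgroup.closure {d : KZ.FormalRep | ∃ ρ : ℂ → KZ.IntegralRep 3,
          (∀ z, IsAlgebraic ℚ z → 0 < z.im → (ρ z).domain = T z ∧
            Set.EqOn (ρ z).integrand (fun p => 1 / p 2 ^ 3) (T z)) ∧
          ∃ (k : ℕ) (z : Fin k → ℂ) (n : Fin k → ℤ), (∀ i, IsAlgebraic ℚ (z i)) ∧ (∀ i, 0 < (z i).im) ∧
            ∑ i, (n i : ℝ) * (ρ (z i)).value = 0 ∧ d = ∑ i, n i • KZ.of (ρ (z i))} :=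
  forall₂_congr fun _ _ => kernel_iff_valueOne _

/-- **`OffTetraSectorKernel` ⟺ ITS CUBE-ORBIT FORM**: the crux holds iff, for the standard ideal-tetrahedron family
`T` and in every dimension, every compact top-dimensional integrand-`1` `ℚ`-semialgebraic solid of volume `1`
reaches the unit cube modulo relations and the tetrahedral value-relators — the residue with no period constant left
in it. [cite: CressonViusos2022, §1 p. 326] -/
theorem offTetraSectorKernel_iff_cubeOrbit :
    Summit.KontsevichZagierPeriods.KontsevichZagierPeriods.Theses.HyperbolicBloch.OffTetraSectorKernel ↔
    ∀ (T : ℂ → Set (Fin 3 → ℝ)), (∀ z, T z = {p | 0 < p 1 ∧ z.re * p 1 < z.im * p 0 ∧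
      z.im * (p 0 - 1) < (z.re - 1) * p 1 ∧ 0 < p 2 ∧
      0 < z.im * (p 0 ^ 2 + p 1 ^ 2 + p 2 ^ 2 - p 0) + (z.re - Complex.normSq z) * p 1}) →
    ∀ (d : ℕ) (K Q : KZ.IntegralRep d), IsCompact K.domain → (interior K.domain).Nonempty →
      (∀ x ∈ K.domain, K.integrand x = 1) → Q.domain = KZ.cube d → (∀ x ∈ Q.domain, Q.integrand x = 1) →
      K.value = 1 →
      KZ.of K - KZ.of Q ∈ KZ.relations ⊔ AddSubgroup.closure {d : KZ.FormalRep | ∃ ρ : ℂ → KZ.IntegralRep 3,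
          (∀ z, IsAlgebraic ℚ z → 0 < z.im → (ρ z).domain = T z ∧
            Set.EqOn (ρ z).integrand (fun p => 1 / p 2 ^ 3) (T z)) ∧
          ∃ (k : ℕ) (z : Fin k → ℂ) (n : Fin k → ℤ), (∀ i, IsAlgebraic ℚ (z i)) ∧ (∀ i, 0 < (z i).im) ∧
            ∑ i, (n i : ℝ) * (ρ (z i)).value = 0 ∧ d = ∑ i, n i • KZ.of (ρ (z i))} :=
  forall₂_congr fun _ _ => kernel_iff_cubeOrbit _

/-- **`OffTetraSectorKernel` ⟺ ITS MOSER FORM**: the crux holds iff, for the standard ideal-tetrahedron family `T`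
and in every dimension, every non-negative `ℚ`-semialgebraic density of mass `1` on the unit cube is move-equivalent
modulo relations and the tetrahedral value-relators to the uniform density. [cite: KontsevichZagier2001, §1.2] -/
theorem offTetraSectorKernel_iff_moserForm :
    Summit.KontsevichZagierPeriods.KontsevichZagierPeriods.Theses.HyperbolicBloch.OffTetraSectorKernel ↔
    ∀ (T : ℂ → Set (Fin 3 → ℝ)), (∀ z, T z = {p | 0 < p 1 ∧ z.re * p 1 < z.im * p 0 ∧
      z.im * (p 0 - 1) < (z.re - 1) * p 1 ∧ 0 < p 2 ∧
      0 < z.im * (p 0 ^ 2 + p 1 ^ 2 + p 2 ^ 2 - p 0) + (z.re - Complex.normSq z) * p 1}) →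
    ∀ (d : ℕ) (G Q : KZ.IntegralRep d), G.domain = KZ.cube d → (∀ x ∈ G.domain, 0 ≤ G.integrand x) →
      Q.domain = KZ.cube d → (∀ x ∈ Q.domain, Q.integrand x = 1) → G.value = 1 →
      KZ.of G - KZ.of Q ∈ KZ.relations ⊔ AddSubgroup.closure {d : KZ.FormalRep | ∃ ρ : ℂ → KZ.IntegralRep 3,
          (∀ z, IsAlgebraic ℚ z → 0 < z.im → (ρ z).domain = T z ∧
            Set.EqOn (ρ z).integrand (fun p => 1 / p 2 ^ 3) (T z)) ∧
          ∃ (k : ℕ) (z : Fin k → ℂ) (n : Fin k → ℤ), (∀ i, IsAlgebraic ℚ (z i)) ∧ (∀ i, 0 < (z i).im) ∧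
            ∑ i, (n i : ℝ) * (ρ (z i)).value = 0 ∧ d = ∑ i, n i • KZ.of (ρ (z i))} :=
  forall₂_congr fun _ _ => kernel_iff_moserForm _

/-! ## §2 The unconditional frontier -/

/-- **ORBITS OF DIMENSION `≤ 1` CLOSE OUTRIGHT** (no oracle): an integrand-`1` representation of `ℝ⁰` or `ℝ¹` of
value `1` is KZ-equivalent to the unit cube of its dimension (tree `stub_dimLeOne`: finitely many real-algebraic cut
points, one Newton–Leibniz move per interval). The first open level of the cube-orbit tower is therefore `d = 2`,
and of the Moser tower `d = 1` (mass-`1` algebraic densities on `[0,1]`: the real `1`-period sector).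
[cite: KontsevichZagier2001, §1.2] -/
theorem cubeOrbit_dimLeOne {d : ℕ} (hd : d ≤ 1) (K Q : KZ.IntegralRep d)
    (hK1 : ∀ x ∈ K.domain, K.integrand x = 1) (hQ : Q.domain = KZ.cube d)
    (hQ1 : ∀ x ∈ Q.domain, Q.integrand x = 1) (hKv : K.value = 1) : KZ.of K - KZ.of Q ∈ KZ.relations :=
  Summit.KontsevichZagierPeriods.SymplecticScissors.LogPolytope.stub_dimLeOne d hd K Q hK1 hQ1
    (hKv.trans (res_value_cubeRep Q hQ hQ1).symm)

/-- **THE EUCLIDEAN AFFINE SECTOR CLOSES OUTRIGHT, every dimension** (`stub_affineOrbit`): the subgroup generated by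
the `ℤ`-value-relators among integrand-`1` representations on real-algebraic affine images `Aᵢ B + bᵢ` of one
`ℚ`-semialgebraic body `B` of finite volume lies in `KZ.relations`. Instances: `ℚ̄`-simplices (Hilbert's third
problem — the Dehn invariant is invisible to rules (1b) + (2)), boxes, ellipsoids.
[cite: KontsevichZagier2001, §1.2 rules (1), (2)] -/
theorem closure_affineOrbit_le_relations :
    AddSubgroup.closure {c : KZ.FormalRep | ∃ (d k : ℕ) (B : Set (Fin d → ℝ))
          (A : Fin k → Matrix (Fin d) (Fin d) ℝ) (b : Fin k → Fin d → ℝ) (m : Fin k → ℤ)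
          (r : Fin k → KZ.IntegralRep d), Literature.ModelTheory.ExponentialFields.IsSemialgebraic ℚ B ∧
          volume B ≠ ⊤ ∧ (∀ i j l, IsAlgebraic ℚ (A i j l)) ∧ (∀ i j, IsAlgebraic ℚ (b i j)) ∧
          (∀ i, (A i).det ≠ 0) ∧ (∀ i, (r i).domain = (fun x => (A i).mulVec x + b i) '' B) ∧
          (∀ i, ∀ x ∈ (r i).domain, (r i).integrand x = 1) ∧ ∑ i, (m i : ℝ) * (r i).value = 0 ∧
          c = ∑ i, m i • KZ.of (r i)} ≤ KZ.relations := by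
  refine (AddSubgroup.closure_le _).mpr ?_
  rintro c ⟨d, k, B, A, b, m, r, hB, hBvol, hA, hb, hdet, hdom, hone, hsum, rfl⟩
  exact stub_affineOrbit d k B A b m r hB hBvol hA hb hdet hdom hone hsum

/-- **THE CRUX HOLDS ON THE EUCLIDEAN AFFINE SECTOR** unconditionally: every element of the subgroup generated by
the affine value-relators (itself a kernel element) lies in `relations ⊔ W` for every oracle `W`. [folklore] -/
theorem offTetraSectorKernel_on_affineSector (W : AddSubgroup KZ.FormalRep) (c : KZ.FormalRep)
    (hc : c ∈ AddSubgroup.closure {c : KZ.FormalRep | ∃ (d k : ℕ) (B : Set (Fin d → ℝ))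
          (A : Fin k → Matrix (Fin d) (Fin d) ℝ) (b : Fin k → Fin d → ℝ) (m : Fin k → ℤ)
          (r : Fin k → KZ.IntegralRep d), Literature.ModelTheory.ExponentialFields.IsSemialgebraic ℚ B ∧
          volume B ≠ ⊤ ∧ (∀ i j l, IsAlgebraic ℚ (A i j l)) ∧ (∀ i j, IsAlgebraic ℚ (b i j)) ∧
          (∀ i, (A i).det ≠ 0) ∧ (∀ i, (r i).domain = (fun x => (A i).mulVec x + b i) '' B) ∧
          (∀ i, ∀ x ∈ (r i).domain, (r i).integrand x = 1) ∧ ∑ i, (m i : ℝ) * (r i).value = 0 ∧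
          c = ∑ i, m i • KZ.of (r i)}) : c ∈ KZ.relations ⊔ W :=
  AddSubgroup.mem_sup_left (closure_affineOrbit_le_relations hc)

end Summit.KontsevichZagierPeriods.HyperbolicBloch.OffTetraSectorKernel

end
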